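import Summits.CriticalPhenomena.PercolationContinuityZ3.Theorems.Transplant.SkelConcParamsFace
import Summits.CriticalPhenomena.PercolationContinuityZ3.Theorems.Transplant.SkelConcInnerAcc
import Summits.CriticalPhenomena.PercolationContinuityZ3.Theorems.Transplant.SkelTubeLevels
import HarnessLib

/-!
# L7.5e: the (F)-side supply lemmas the face residue's last mile consumes — the chain property at the inner accuracy `δA` (the `hchain`
# binder of `Skel.hroute_face'`, every length `n ≤ nmaxA K`, every window graph `Skel.winGraph G o L_A`), and the four planar/radius
# inequalities of `hroute_face'` at the generic level window `[8 M + 13, 8 M + 12 + L]` (`hbig`, `h10s`, `hRl`) and the inner radius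
# (`hLA : 28 r + 2 Rlev ≤ L_A`, `hℓL : ψ ℓ1 ≤ L_A`)

builds on p205010 (kernel theorem, internal audit signed; external expert review pending) — nothing in this file uses p205010.
Status sentence (coordinator 2026-08-20T04:30Z): "θ(p_c) = 0 on ℤ^d, all d ≥ 2 — kernel-verified (Lean 4/Mathlib, standard axioms); internal
adversarial audit SIGNED 2026-08-20 04:29Z; external expert review pending."
Lane `prim-bschramm-*`, seat `prim-bschramm-p3` (gen 6; design owner, referee note 2026-08-20T23:14Z NOTES 1–3); helper file
(`--supports stmt-CriticalPhenomena-4575`).  NEW FILE over stmt-g7's `SkelConcParamsFace` / `SkelConcInnerAcc` (no statement there is touched).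

* **`SkelConc.δA_spec`**, **`SkelConc.δA_spec_win`** — twin of `SkelConc.δC_spec` (SkelConcClosureHab) for the inner-route accuracy
  `δA Φ K₀ δ₂ = min_{n ≤ nmaxA K} δUP Φ n (δ₂²)`: the `hchain` shape at accuracy `δA`, delivering `1 − δ₂²`, every `n ≤ nmaxA (Kof K₀)`,
  every `q < 1`, every subgraph / window graph (`δUP_spec` + `TStep.KitsAt.mono (δA_le_δUP …)`);
* `SkelConc.Conc.nmax_le_nmaxA` (`12 K ≤ nmaxA K`), `face_hRl'` (`(8M + 12 + L) + 1 ≤ R'`, equality), `face_hbig'`, `face_h10s'` (the two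
  planar inequalities of `hroute_face'` with `Rlev := 8 M + 12 + L` instead of the product's `M + L`), `face_hLA` (`28 r + 2 (8M + 12 + L) ≤ L_A`),
  `face_hℓL` (`ψ (M + s + 2 R' + 1) ≤ L_A`).
[cite: KozmaNitzan2024, §4 Lemma 11 (pp. 22–23), Lemma 12 (pp. 23–25), Theorem 6 (pp. 25–31)]
-/

noncomputable section

open MeasureTheory ProbabilityTheory
open scoped Classical

namespace Summit.CriticalPhenomena.PercolationContinuityZ3.Theorems

namespace Transplant

namespace SkelConc

open Literature.Probability.Percolation Literature.Probability.LatticeModels SimpleGraph KNCells KNLevels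
open BoxProdZ2 (nmaxA Kof twenty_le_Kof)

/-! ## §1 The chain property at the inner accuracy `δA` -/

section DeltaA

variable {V : Type} [DecidableEq V] [Countable V] {G : SimpleGraph V} [G.LocallyFinite] (Φ : PlanarSkeletonConc G)

/-- **The chain property of every length `n ≤ nmaxA K` at the inner accuracy `δA Φ K₀ δ₂`**, in every subgraph `G' ≤ G`, for every `q < 1`,
delivering `1 − δ₂²` (`δUP_spec` + `KitsAt.mono`; twin of `δC_spec`). [cite: KozmaNitzan2024, §4 Lemma 12 (pp. 23–25)] -/
theorem δA_spec (K₀ : ℕ) {δ₂ : ℝ} (hδ₂ : 0 < δ₂) {n : ℕ} (hn : n ≤ nmaxA (Kof K₀)) {q : unitInterval} (hq1 : (q : ℝ) < 1)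
    (G' : SimpleGraph V) [G'.LocallyFinite] (hG' : G' ≤ G) :
    ∀ (Wt : Sym2 V → unitInterval) (s : Fin (n + 1) → TStep G') (T' : Fin (n + 1) → Finset V) (η : ℝ),
      (∀ i : Fin (n + 1), (s i).L.o = (s 0).L.o) →
      (∀ i : Fin n, T' (Fin.castSucc i) ⊆ (s i.succ).L.X 0) →
      (∀ i : Fin (n + 1), T' i ⊆ (s i).T) →
      (∀ i : Fin (n + 1), (s i).KitsAt Wt q Φ.Δ (δA Φ K₀ δ₂)) →
      η ≤ δA Φ K₀ δ₂ / 2 →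
      (∀ i : Fin (n + 1), (prodBernoulli Wt).real (⋃ t ∈ (s i).T \ T' i, openConn (s 0).L.o t) ≤ η) →
      1 - δA Φ K₀ δ₂ < (prodBernoulli Wt).real (s 0).L.reachB →
        1 - δ₂ ^ 2 < (prodBernoulli Wt).real (⋃ t ∈ T' (Fin.last n), openConn (s 0).L.o t) := by
  intro Wt s T' η ho hlink hsub hkits hη hexc hsrc
  have hle := δA_le_δUP Φ K₀ δ₂ hn
  exact δUP_spec Φ n (pow_pos hδ₂ 2) q hq1 G' hG' Wt s T' η ho hlink hsub (fun i => (hkits i).mono hle) (hη.trans (by linarith)) hexc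
    (by linarith)

/-- **`δA_spec` for the window graphs `Skel.winGraph G c Rπ`** — the `hchain` binder of `Skel.hroute_face'` VERBATIM (with `nmax ≤ nmaxA K`,
`Δ' := Φ.Δ`, `δ := δA Φ K₀ δ₂`, `ε'' := δ₂²`). [cite: KozmaNitzan2024, §4 Lemma 11 (pp. 22–23), Lemma 12 (pp. 23–25)] -/
theorem δA_spec_win (K₀ : ℕ) {δ₂ : ℝ} (hδ₂ : 0 < δ₂) {nmax : ℕ} (hnmax : nmax ≤ nmaxA (Kof K₀)) {q : unitInterval}
    (hq1 : (q : ℝ) < 1) (c : V) (Rπ : ℕ) :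
    ∀ n ≤ nmax, ∀ (Wt : Sym2 V → unitInterval) (s : Fin (n + 1) → TStep (Skel.winGraph G c Rπ)) (T' : Fin (n + 1) → Finset V) (η : ℝ),
      (∀ i : Fin (n + 1), (s i).L.o = (s 0).L.o) →
      (∀ i : Fin n, T' (Fin.castSucc i) ⊆ (s i.succ).L.X 0) →
      (∀ i : Fin (n + 1), T' i ⊆ (s i).T) →
      (∀ i : Fin (n + 1), (s i).KitsAt Wt q Φ.Δ (δA Φ K₀ δ₂)) →
      η ≤ δA Φ K₀ δ₂ / 2 →
      (∀ i : Fin (n + 1), (prodBernoulli Wt).real (⋃ t ∈ (s i).T \ T' i, openConn (s 0).L.o t) ≤ η) →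
      1 - δA Φ K₀ δ₂ < (prodBernoulli Wt).real (s 0).L.reachB →
        1 - δ₂ ^ 2 < (prodBernoulli Wt).real (⋃ t ∈ T' (Fin.last n), openConn (s 0).L.o t) :=
  fun _ hn => δA_spec Φ K₀ hδ₂ (hn.trans hnmax) hq1 (Skel.winGraph G c Rπ) (Skel.winGraph_le G c Rπ)

end DeltaA

/-! ## §2 The planar / radius inequalities of `hroute_face'` at the generic level window -/

namespace Conc

section Consts

variable {κ : Consts} {V : Type} [Countable V] {G : SimpleGraph V} [G.LocallyFinite] {Φ : PlanarSkeletonConc G}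
  {p : unitInterval} {hC : Φ.toPlanarSkeleton.CylSubcritical p} {δA : ℝ} {M : ℕ}

/-- `nmax := 12 K ≤ nmaxA K = 1000 K`. [folklore] -/
theorem nmax_le_nmaxA : 12 * Kof κ.K₀ ≤ nmaxA (Kof κ.K₀) := by unfold nmaxA; omega

/-- `nmax := 12 · C.K ≤ nmaxA K` (the cells' `K` is `Kof K₀`). [folklore] -/
theorem nmax_le_nmaxA' : 12 * (Cc κ Φ p hC δA M).K ≤ nmaxA (Kof κ.K₀) := by rw [Cc_K]; exact nmax_le_nmaxA

/-- `hRl'`: the generic level window's top `Rlev := 8 M + 12 + L` satisfies `Rlev + 1 ≤ R'` (equality, `R' = L + 8 M + 13`). [folklore] -/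
theorem face_hRl' : (8 * M + 12 + Lc κ Φ p hC δA M) + 1 ≤ R'c κ Φ p hC δA M := by rw [R'c_eq]; omega

/-- `Rlev := 8 M + 12 + L ≤ R'`. [folklore] -/
theorem face_Rlev_le : 8 * M + 12 + Lc κ Φ p hC δA M ≤ R'c κ Φ p hC δA M := by rw [R'c_eq]; omega

/-- `hbig'`: `Rlev + ℓ1 + 2 s + (nmax + 3) R' ≤ r` for the generic `Rlev := 8 M + 12 + L`, `ℓ1 := M + s + 2 R' + 1`, `nmax := 12 K`.
[folklore] -/
theorem face_hbig' : (8 * M + 12 + Lc κ Φ p hC δA M) + (M + (Cc κ Φ p hC δA M).s + 2 * R'c κ Φ p hC δA M + 1) +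
    2 * (Cc κ Φ p hC δA M).s + (12 * Kof κ.K₀ + 3) * R'c κ Φ p hC δA M ≤ (Cc κ Φ p hC δA M).r := by
  have hK := twenty_le_Kof κ.K₀
  have hR := lt_R'c' (κ := κ) (Φ := Φ) (p := p) (hC := hC) (δA := δA) (M := M)
  have hRL : 8 * M + 12 + Lc κ Φ p hC δA M + 1 ≤ R'c κ Φ p hC δA M := face_hRl'
  rw [Cc_r_eq, Cc_s]
  generalize hKdef : Kof κ.K₀ = K at hK ⊢
  generalize hLdef : Lc κ Φ p hC δA M = L at hRL ⊢
  generalize hRdef : R'c κ Φ p hC δA M = R at hR hRL ⊢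
  have h1 : 7760 * R ≤ 388 * K * R := by
    have := Nat.mul_le_mul_right R (show 7760 ≤ 388 * K by omega)
    simpa [Nat.mul_assoc] using this
  have h2 : 8000 ≤ 400 * K := by omega
  have h3 : K * (400 * (R + 1)) = 12 * K * R + (388 * K * R + 400 * K) := by ring
  have h4 : (12 * K + 3) * R = 12 * K * R + 3 * R := by ring
  rw [h3, h4]
  generalize 12 * K * R = A at *
  generalize 388 * K * R = B at *
  generalize 400 * K = D at *
  omega

/-- `h10s'`: `Rlev + ℓ1 + 3 ≤ 10 s` for the generic `Rlev := 8 M + 12 + L`. [folklore] -/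
theorem face_h10s' : (8 * M + 12 + Lc κ Φ p hC δA M) + (M + (Cc κ Φ p hC δA M).s + 2 * R'c κ Φ p hC δA M + 1) + 3 ≤
    10 * (Cc κ Φ p hC δA M).s := by
  have hR := lt_R'c' (κ := κ) (Φ := Φ) (p := p) (hC := hC) (δA := δA) (M := M)
  have hRL : 8 * M + 12 + Lc κ Φ p hC δA M + 1 ≤ R'c κ Φ p hC δA M := face_hRl'
  rw [Cc_s]; omega

/-- `hRlev'`: `Rlev + 4 ≤ 10 s` for `Rlev := 8 M + 12 + L`. [folklore] -/
theorem face_hRlev' : 8 * M + 12 + Lc κ Φ p hC δA M + 4 ≤ 10 * (Cc κ Φ p hC δA M).s := by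
  have h := face_h10s' (κ := κ) (Φ := Φ) (p := p) (hC := hC) (δA := δA) (M := M); omega

end Consts

section Sched

variable {κ : Consts} {V : Type} [Countable V] {G : SimpleGraph V} [G.LocallyFinite] {Φ : PlanarSkeletonConc G}
  {p : unitInterval} {hC : Φ.toPlanarSkeleton.CylSubcritical p} {δA : ℝ} {M : ℕ} {q : unitInterval}

/-- `hLA`: the inner radius absorbs the inner run's planar travel AND the thickened face row: `28 r + 2 Rlev ≤ L_A` for `Rlev := 8 M + 12 + L`
(`L_A = 24 r + 2(ψ(6t) + ψ M) + R₁A + dL`, `dL = 24 t + 8 M + 12`, `r = 4 t`, `2 R' ≤ 8 t`). [folklore] -/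
theorem face_hLA : 28 * (Cc κ Φ p hC δA M).r + 2 * (8 * M + 12 + Lc κ Φ p hC δA M) ≤ LAc κ Φ p hC δA M q := by
  have hRt := hℓ₀ (κ := κ) (Φ := Φ) (p := p) (hC := hC) (δA := δA) (M := M)
  have hRL : 8 * M + 12 + Lc κ Φ p hC δA M + 1 ≤ R'c κ Φ p hC δA M := face_hRl'
  have h4 := hr (κ := κ) (Φ := Φ) (p := p) (hC := hC) (δA := δA) (M := M)
  have h100 := hR100 (κ := κ) (Φ := Φ) (p := p) (hC := hC) (δA := δA) (M := M)
  unfold LAc; rw [dL_eq, h4]; omega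

/-- `hLA` with any `Rlev ≤ R'`. [folklore] -/
theorem face_hLA_of_le {Rlev : ℕ} (hRlev : Rlev ≤ R'c κ Φ p hC δA M) :
    28 * (Cc κ Φ p hC δA M).r + 2 * Rlev ≤ LAc κ Φ p hC δA M q := by
  have hRt := hℓ₀ (κ := κ) (Φ := Φ) (p := p) (hC := hC) (δA := δA) (M := M)
  have h4 := hr (κ := κ) (Φ := Φ) (p := p) (hC := hC) (δA := δA) (M := M)
  have h100 := hR100 (κ := κ) (Φ := Φ) (p := p) (hC := hC) (δA := δA) (M := M)
  unfold LAc; rw [dL_eq, h4]; omega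

/-- `hℓL`: `ψ ℓ1 ≤ L_A` for `ℓ1 := M + s + 2 R' + 1 ≤ 6 t`. [folklore] -/
theorem face_hℓL : ψ Φ p hC (M + (Cc κ Φ p hC δA M).s + 2 * R'c κ Φ p hC δA M + 1) ≤ LAc κ Φ p hC δA M q := by
  have h1 : ψ Φ p hC (M + (Cc κ Φ p hC δA M).s + 2 * R'c κ Φ p hC δA M + 1) ≤ ψ Φ p hC (6 * tc κ Φ p hC δA M) := ψ_mono face_hℓ1A
  have h2 := face_hLRA (κ := κ) (Φ := Φ) (p := p) (hC := hC) (δA := δA) (M := M) (q := q)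
  omega

/-- `ψ ℓ ≤ L_A` for every scale `ℓ ≤ 6 t` (all inner route scales). [folklore] -/
theorem face_ψ_le_LA {ℓ : ℕ} (hℓ : ℓ ≤ 6 * tc κ Φ p hC δA M) : ψ Φ p hC ℓ ≤ LAc κ Φ p hC δA M q := by
  have h1 : ψ Φ p hC ℓ ≤ ψ Φ p hC (6 * tc κ Φ p hC δA M) := ψ_mono hℓ
  have h2 := face_hLRA (κ := κ) (Φ := Φ) (p := p) (hC := hC) (δA := δA) (M := M) (q := q)
  omega

end Sched

/-! ## §3 APPEND (p3-g6, referee note 2026-08-21T00:04Z): the inner radius WITH THE KIT REACH — `L_A := LAc + reachK`, `L'_A := ψ(6t) + ψ M + reachK`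
The inner kits need `r₀ ≤ L'_A` (`Skel.innerKits'`), and `r₀c` contains the comparison radius `Rseedc` (no bound by `ψ`/`t`); `reachK ≥ r₀c` absorbs it,
and `Conc.LA_reach_le_L'` has exactly this slack in `L'c`.  No landed constant changes. -/

section Reach

variable {κ : Consts} {V : Type} [Countable V] {G : SimpleGraph V} [G.LocallyFinite] {Φ : PlanarSkeletonConc G}
  {p : unitInterval} {hC : Φ.toPlanarSkeleton.CylSubcritical p} {δA : ℝ} {M : ℕ} {q : unitInterval}

/-- `hr₀LA'`: `r₀ ≤ L'_A` for `L'_A := ψ(6t) + ψ M + reachK` (`r₀c ≤ reachK`). [folklore] -/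
theorem face_hr₀LA' : r₀c Φ p hC M ≤ ψ Φ p hC (6 * tc κ Φ p hC δA M) + ψ Φ p hC M + reachK Φ p hC M := by
  have h := (r₀c_le (Φ := Φ) (p := p) (hC := hC) (M := M)).2; omega

/-- `hLψA'`: `ψ(6t) + ψ M ≤ L'_A`. [folklore] -/
theorem face_hLψA' : ψ Φ p hC (6 * tc κ Φ p hC δA M) + ψ Φ p hC M ≤ ψ Φ p hC (6 * tc κ Φ p hC δA M) + ψ Φ p hC M + reachK Φ p hC M :=
  Nat.le_add_right _ _

/-- `hLRA'`: `L'_A ≤ L_A` for `L_A := LAc + reachK`. [folklore] -/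
theorem face_hLRA' : ψ Φ p hC (6 * tc κ Φ p hC δA M) + ψ Φ p hC M + reachK Φ p hC M ≤ LAc κ Φ p hC δA M q + reachK Φ p hC M := by
  have h := face_hLRA (κ := κ) (Φ := Φ) (p := p) (hC := hC) (δA := δA) (M := M) (q := q); omega

/-- `hRA'`: the inner excess radius fits: `Rexc q (2 ψ M) ≤ L_A − L'_A`. [folklore] -/
theorem face_hR₁LA' : Rexc κ Φ p hC δA M q (2 * ψ Φ p hC M) ≤
    (LAc κ Φ p hC δA M q + reachK Φ p hC M) - (ψ Φ p hC (6 * tc κ Φ p hC δA M) + ψ Φ p hC M + reachK Φ p hC M) := by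
  have h := face_hR₁LA (κ := κ) (Φ := Φ) (p := p) (hC := hC) (δA := δA) (M := M) (q := q)
  have h2 := face_hLRA (κ := κ) (Φ := Φ) (p := p) (hC := hC) (δA := δA) (M := M) (q := q)
  omega

/-- `hLd'`: the enlarged inner radius still fits under the collar: `L_A + ψ M + 1 ≤ L'` (indeed `+ 2 ψ M`, `Conc.LA_reach_le_L'`). [folklore] -/
theorem face_hLd' : LAc κ Φ p hC δA M q + reachK Φ p hC M + ψ Φ p hC M + 1 ≤ L'c κ Φ p hC δA M q := by
  have h := LA_reach_le_L' (κ := κ) (Φ := Φ) (p := p) (hC := hC) (δA := δA) (M := M) (q := q); omega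

/-- `hLd''`: with `2 ψ M`. [folklore] -/
theorem face_hLd'' : LAc κ Φ p hC δA M q + reachK Φ p hC M + 2 * ψ Φ p hC M + 1 ≤ L'c κ Φ p hC δA M q := by
  have h := LA_reach_le_L' (κ := κ) (Φ := Φ) (p := p) (hC := hC) (δA := δA) (M := M) (q := q); omega

/-- `hLA'`: `28 r + 2 Rlev ≤ L_A` for `Rlev := 8 M + 12 + L`, `L_A := LAc + reachK`. [folklore] -/
theorem face_hLA' : 28 * (Cc κ Φ p hC δA M).r + 2 * (8 * M + 12 + Lc κ Φ p hC δA M) ≤ LAc κ Φ p hC δA M q + reachK Φ p hC M :=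
  (face_hLA (q := q)).trans (Nat.le_add_right _ _)

/-- `hℓL'`: `ψ ℓ1 ≤ L_A` for `L_A := LAc + reachK`. [folklore] -/
theorem face_hℓL' : ψ Φ p hC (M + (Cc κ Φ p hC δA M).s + 2 * R'c κ Φ p hC δA M + 1) ≤ LAc κ Φ p hC δA M q + reachK Φ p hC M :=
  (face_hℓL (q := q)).trans (Nat.le_add_right _ _)

/-- `ψ ℓ ≤ L_A` for every scale `ℓ ≤ 6 t`, `L_A := LAc + reachK`. [folklore] -/
theorem face_ψ_le_LA' {ℓ : ℕ} (hℓ : ℓ ≤ 6 * tc κ Φ p hC δA M) : ψ Φ p hC ℓ ≤ LAc κ Φ p hC δA M q + reachK Φ p hC M :=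
  (face_ψ_le_LA (q := q) hℓ).trans (Nat.le_add_right _ _)

end Reach

end Conc

end SkelConc

end Transplant

end Summit.CriticalPhenomena.PercolationContinuityZ3.Theorems

end
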